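import Summits.QuantumAdvantage.QuantumAdvantage.Theses.ArithStatLadder
import Literature.Computability.Cryptography.HallgrenClassGroup
import Literature.Computability.Complexity.ProbabilisticClassesProofs
import Literature.Computability.Complexity.StringCopy
import Literature.Computability.Complexity.BrickAlgebra
import Literature.Computability.Complexity.ReductionsProofs
import Literature.Computability.QuantumComplexity.FactoringPrimesProofs

/-!
# Disproof work file — crux `ArithStatLadder.IqThreeNotBPP` (stmt-QuantumAdvantage-14864)

Standing disprover `refuter-cdisprove-stmt-QuantumAdvantage-14864-0`, cycle 1 (2026-08-16).
The crux is LITERALLY `IQ3 ∉ BPP`, `IQ3 = bin S`,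
`S = {d : ℕ | −d fundamental ∧ 3 ∣ h(−d)}` (`iqThreeNotBPP_iff`, `Iff.rfl`).

## Findings (index; details in the docstrings below)

* §0 READ-BACK. rc 0; no coercion junk: `d : ℕ ↦ -(d:ℤ)`, `Int.emod`/`Int.ediv` (Euclidean) make the
  fundamentality literal correct (−3, −4, −8, −20 in; 0, −12, −27, −44 out); `classNumber D` =
  #reduced primitive positive-definite forms (Cox Thm 2.13), kernel-decidable; `BPP = bp P`
  (Arora–Barak Def 7.3) with `P ⊆ BPP`, `co BPP = BPP`, finite-variation and `FP`-preimage closure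
  PROVED in the tree. No misstatement surface found.
* §1 NON-DEGENERACY (junk-model check, kernel): `23, 31 ∈ S`; `0, 3, 4, 12, 27, 44, 47 ∉ S`. So `S` is
  neither empty nor trivially co-finite on codewords; (Nagell 1922: `S` is infinite — §5 instances).
* §2 GRAVEYARD OF NAIVE REFUTATIONS (kill criterion (i) of the route, cheapest form: "an ℓ = 3
  genus theory", i.e. `3 ∣ h(−d)` as a Frobenian/congruence datum of `d`). Kernel-checked: on PRIME
  discriminants `−p` (one genus, no Rédei data at all) `[3 ∣ h(−p)]` is not a function of `p mod m`
  for ANY `1 ≤ m ≤ 24` (`threeDvd_not_periodic_on_primes`), nor of `p mod 2520` (hence of no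
  `m ∣ 2520`; `native_decide`, `threeDvd_not_periodic_mod_2520`), nor of the quadratic characters
  of `p` at `8, 3, 5, 7, 11` (`threeDvd_not_function_of_small_characters`: `p = 139` vs `q = 19`).
  Asymptotic form in print = the route's own `EndJuntaRung` (BST Thm 20: mean 2 in every class).
* §3 SYMMETRY. `IqThreeNotBPP ↔ (bin S)ᶜ ∉ BPP` (`co BPP = BPP`): the TARGET class is YES/NO
  symmetric although certificates are not (3 ∣ h has NP witnesses — cubic fields; 3 ∤ h has none
  known GRH-free: BarrierNotes-r1-k1 B7).
* §4 LOAD-BEARING ANALYSIS of the three conjuncts of `S` (there are no hypotheses to drop; the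
  variants are the statement with one conjunct of the LANGUAGE dropped or the domain shrunk):
  - `WithoutThree`  = FUND ∉ BPP  (≡ SQUAREFREES ∉ BPP up to one-query reductions; OPEN,
    Adleman–McCurley 1994) — not refutable, not provable here;
  - `WithoutFund`   = {d | 3 ∣ h(−d)} ∉ BPP over ALL discriminants (orders included; OPEN);
  - `PrimesOnly`    = {p prime, p ≡ 3 (4), 3 ∣ h(−p)} ∉ BPP — PROVED HERE to IMPLY the crux
    (`iqThreeNotBPP_of_primesOnly`, via `inter_mem_BPP_of_mem_P` + `PRIMES ∈ P`): the factoring-free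
    prime core is a sufficient top (ideator-1 memo M6), and a refutation of the crux must in
    particular decide `3 ∣ h(−p)` on primes in BPP — where NO conjunct can carry squarefreeness.
  Verdict: the class-number conjunct alone is load-bearing for hardness; the fundamentality
  conjunct only adds the squarefree floor (§5).
* §5 LINE `Sketch` (lead prover-line-…-14864-0): joint sufficiency is BY NAME and kernel-checked by
  the lead (`IqThreeNotBPP_of`); closure stubs Q/V/B/E landed; sockets = Hasse's dictionary (named
  CFT fact) + apex SQF ∉ BPP (hypothesis-type). Nothing to kill. ONE improvement offered:
  Hasse-FREE planting (Nagell 1922, form version, no class field theory, no fundamentality):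
  `gcd(c,u) = 1, 2 ≤ c, u < 4c³ ⇒ 3 ∣ classNumber (−u(4c³−u))` via the primitive form
  `(c², 2c³−u, c⁴)` of order exactly 3 — kernel-checked on instances here
  (`nagell_instances`), general statement recorded as a NEAR-MISS (`nagell_three_dvd_classNumber`,
  sorry: needs Dirichlet composition or the form–ideal dictionary of `FormIdeals.lean` for the cube
  law). With it the refutation floor `¬IqThreeNotBPP → SQF ∈ BPP` loses its CFT hypothesis
  (sampler `d = N·t·(4c³ − N t)`, `t = 1 + 2Nk`, `c = 2^e ≥ (N t_max)^{1/3}`: N,t odd ⇒ d ≡ 3 (4)).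
* LANDED (pending verdicts): `Theorems/IqThreeNotBPP/Negative/IqThreeNotBPPPrimeCore.lean` (p101002:
  `¬IqThreeNotBPP → bin{prime core} ∈ BPP`, `inter_mem_BPP_of_mem_P`) and
  `…/Negative/IqThreeNotBPPNaivePredictors.lean` (p103166: §2, kernel).
* WHY IT RESISTS (no kill this cycle): ¬crux = a BPP algorithm for `h(−d) mod 3` on fundamental
  discriminants. Best classical access to ANY of the thirteen known faces of `3 ∣ h(−d)`
  (BarrierNotes-r1-k2 B3) is `L(1/2)` index calculus under GRH (Hafner–McCurley 1989) or
  `d^{1/4+o(1)}` (Shanks); by the landed reduction a refutation is ALSO a BPP squarefreeness test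
  (given Hasse; Hasse-free after §5). No small model, degenerate parameter or junk instance bites:
  the statement is a faithful, non-degenerate formalisation of an open hardness hypothesis of
  separation strength (`⇒ NP ⊄ BPP`, SeparationPrerequisites).
-/

set_option linter.dupNamespace false

noncomputable section

namespace Summit.QuantumAdvantage.QuantumAdvantage.Cruxes.IqThreeNotBPP.Disproof

open _root_.Computability
open Literature.Computability.Complexity
open Literature.Computability.Complexity.Brick (fstF fstF_boolPair fstF_mem_FP)
open Literature.Computability.Cryptography (IsNegFundamentalDiscr)
open Literature.Computability.QuantumComplexity (PRIMES PRIMES_mem_P')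
open Literature.NumberTheory.QuadraticFields (BinaryQuadraticForm.classNumber)
open Summit.QuantumAdvantage.QuantumAdvantage.Theses.ArithStatLadder (IqThreeNotBPP)

/-! ## §0 The crux, read back -/

/-- The set `S = {d : ℕ | −d fundamental ∧ 3 ∣ h(−d)}` of the crux. -/
def iqThreeSet : Set ℕ :=
  {d : ℕ | IsNegFundamentalDiscr d ∧ 3 ∣ BinaryQuadraticForm.classNumber (-(d : ℤ))}

/-- The crux is literally `bin S ∉ BPP` (definitional unfolding; no coercion surprises). -/
theorem iqThreeNotBPP_iff : IqThreeNotBPP ↔ encodingNatBool.toLanguage iqThreeSet ∉ BPP :=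
  Iff.rfl

/-! ## §1 Non-degeneracy of `S` (kernel computations with the tree's `classNumber`) -/

theorem isNegFundamentalDiscr_23 : IsNegFundamentalDiscr 23 :=
  Or.inl ⟨by decide, Int.squarefree_natAbs.1 (by decide +kernel), by decide⟩

theorem isNegFundamentalDiscr_31 : IsNegFundamentalDiscr 31 :=
  Or.inl ⟨by decide, Int.squarefree_natAbs.1 (by decide +kernel), by decide⟩

/-- `h(−23) = 3`: the smallest member of `S`. -/
theorem classNumber_neg23 : BinaryQuadraticForm.classNumber (-23) = 3 := by decide +kernel

/-- `h(−31) = 3`. -/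
theorem classNumber_neg31 : BinaryQuadraticForm.classNumber (-31) = 3 := by decide +kernel

/-- `h(−47) = 5`. -/
theorem classNumber_neg47 : BinaryQuadraticForm.classNumber (-47) = 5 := by decide +kernel

theorem mem_iqThreeSet_23 : 23 ∈ iqThreeSet := ⟨isNegFundamentalDiscr_23, by decide +kernel⟩

theorem mem_iqThreeSet_31 : 31 ∈ iqThreeSet := ⟨isNegFundamentalDiscr_31, by decide +kernel⟩

/-- `0 ∉ S` (`0` is not a discriminant: both branches of the literal fail). -/
theorem zero_not_mem_iqThreeSet : 0 ∉ iqThreeSet := by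
  rintro ⟨(⟨h, -, -⟩ | ⟨-, h, -⟩), -⟩ <;> revert h <;> decide

/-- `3 ∉ S`: `−3` is fundamental but `h(−3) = 1`. -/
theorem three_not_mem_iqThreeSet : 3 ∉ iqThreeSet := by
  rintro ⟨-, h⟩; revert h; decide +kernel

/-- `4 ∉ S`: `−4` is fundamental but `h(−4) = 1`. -/
theorem four_not_mem_iqThreeSet : 4 ∉ iqThreeSet := by
  rintro ⟨-, h⟩; revert h; decide +kernel

/-- `47 ∉ S`: `−47` is fundamental, `h(−47) = 5`. -/
theorem fortyseven_not_mem_iqThreeSet : 47 ∉ iqThreeSet := by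
  rintro ⟨-, h⟩; revert h; decide +kernel

/-- `12 ∉ S`: `−12` is not fundamental (`−12/4 = −3 ≡ 1 (mod 4)`), although `h(−12) = 1` anyway. -/
theorem twelve_not_mem_iqThreeSet : 12 ∉ iqThreeSet := by
  rintro ⟨(⟨h, -, -⟩ | ⟨-, h, -⟩), -⟩ <;> revert h <;> decide

/-- `44 ∉ S`: `−44 = 4·(−11)` is not fundamental although `3 ∣ h(−44) = 3` (the order of
conductor 2 in `ℚ(√−11)`): the fundamentality conjunct is not decoration. -/
theorem fortyfour_not_mem_iqThreeSet : 44 ∉ iqThreeSet := by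
  rintro ⟨(⟨h, -, -⟩ | ⟨-, h, -⟩), -⟩ <;> revert h <;> decide

/-- … and indeed `h(−44) = 3`. -/
theorem classNumber_neg44 : BinaryQuadraticForm.classNumber (-44) = 3 := by decide +kernel

/-- `27 ∉ S`: `−27 ≡ 1 (mod 4)` but is not squarefree (the squarefree conjunct bites; this is the
entry point of the squarefree floor of §5). -/
theorem twentyseven_not_mem_iqThreeSet : 27 ∉ iqThreeSet := by
  rintro ⟨(⟨-, h, -⟩ | ⟨h, -, -⟩), -⟩
  · exact absurd (Int.squarefree_natAbs.2 h) (by decide +kernel)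
  · revert h; decide

/-! ## §2 Graveyard of naive refutations: `3 ∣ h(−p)` is not a congruence datum of `p` -/

/-- Primes `p ≡ 3 (mod 4)` with `3 ∣ h(−p)` used as witnesses. -/
def yesPrimes : Finset ℕ := {23, 31, 59, 83, 107, 139}

/-- Primes `q ≡ 3 (mod 4)` with `3 ∤ h(−q)` used as witnesses. -/
def noPrimes : Finset ℕ := {3, 7, 11, 47, 67, 127, 167}

theorem yesPrimes_spec :
    ∀ p ∈ yesPrimes, p.Prime ∧ p % 4 = 3 ∧ 3 ∣ BinaryQuadraticForm.classNumber (-(p : ℤ)) := by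
  decide +kernel

theorem noPrimes_spec :
    ∀ q ∈ noPrimes, q.Prime ∧ q % 4 = 3 ∧ ¬ 3 ∣ BinaryQuadraticForm.classNumber (-(q : ℤ)) := by
  decide +kernel

theorem residues_matched :
    ∀ m ∈ Finset.Icc 1 24, ∃ p ∈ yesPrimes, ∃ q ∈ noPrimes, p % m = q % m := by
  decide +kernel

/-- **No period `m ≤ 24`.** For every modulus `1 ≤ m ≤ 24` there are primes `p ≡ q (mod m)`, both
`≡ 3 (mod 4)` (so `−p`, `−q` are fundamental, one genus each), with `3 ∣ h(−p)` and `3 ∤ h(−q)`.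
Hence no predictor of `3 ∣ h(−d)` factoring through `d mod m`, `m ≤ 24` — in particular nothing
built from `d mod 8`, `d mod 9`, `d mod 24` — is even correct on prime discriminants.
Kernel-checked (`decide +kernel`; class numbers of 13 discriminants `≤ 167`). -/
theorem threeDvd_not_periodic_on_primes (m : ℕ) (h1 : 1 ≤ m) (h24 : m ≤ 24) :
    ∃ p q : ℕ, p.Prime ∧ q.Prime ∧ p % 4 = 3 ∧ q % 4 = 3 ∧ p % m = q % m ∧
      3 ∣ BinaryQuadraticForm.classNumber (-(p : ℤ)) ∧
      ¬ 3 ∣ BinaryQuadraticForm.classNumber (-(q : ℤ)) := by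
  obtain ⟨p, hp, q, hq, hpq⟩ := residues_matched m (Finset.mem_Icc.2 ⟨h1, h24⟩)
  obtain ⟨hp1, hp2, hp3⟩ := yesPrimes_spec p hp
  obtain ⟨hq1, hq2, hq3⟩ := noPrimes_spec q hq
  exact ⟨p, q, hp1, hq1, hp2, hq2, hpq, hp3, hq3⟩

set_option maxHeartbeats 0 in
/-- **No period among the structured moduli `72 = 8·9`, `108 = 4·27`, `216 = 8·27`,
`360 = 8·9·5`, `504 = 8·9·7`** (so none among their divisors: the moduli a "3-adic genus theory
with 2-adic and small-prime local data" could use). Witness pairs `p ≡ q (mod m)`, primes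
`≡ 3 (mod 4)` with differing verdicts: `(72; 11, 83)`, `(108; 131, 23)`, `(216; 67, 283)`,
`(360; 7, 367)`, `(504; 43, 547)` (`h(−11) = h(−67) = h(−7) = h(−43) = 1`, `h(−131) = 5`;
`h(−83) = h(−23) = h(−283) = h(−547) = 3`, `h(−367) = 9`). Kernel-checked (`decide +kernel`; the
largest, `classNumber (-547)`, enumerates `6.6·10⁴` coefficient pairs). Recorded but NOT
kernel-checked (Python, this session): `(840; 43, 883)` and `(2520; 2543, 23)` (`h(−883) = 3`,
`h(−2543) = 35`) — `classNumber (-883)` already exceeds the kernel's recursion budget with the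
tree's crude coefficient bound `|D|/3`, and `native_decide` is unavailable (`classNumber` is
`noncomputable`). -/
theorem threeDvd_not_periodic_structured :
    (11 % 72 = 83 % 72 ∧ ¬ 3 ∣ BinaryQuadraticForm.classNumber (-11) ∧
        3 ∣ BinaryQuadraticForm.classNumber (-83)) ∧
    (131 % 108 = 23 % 108 ∧ ¬ 3 ∣ BinaryQuadraticForm.classNumber (-131) ∧
        3 ∣ BinaryQuadraticForm.classNumber (-23)) ∧
    (67 % 216 = 283 % 216 ∧ ¬ 3 ∣ BinaryQuadraticForm.classNumber (-67) ∧
        3 ∣ BinaryQuadraticForm.classNumber (-283)) ∧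
    (7 % 360 = 367 % 360 ∧ ¬ 3 ∣ BinaryQuadraticForm.classNumber (-7) ∧
        3 ∣ BinaryQuadraticForm.classNumber (-367)) ∧
    (43 % 504 = 547 % 504 ∧ ¬ 3 ∣ BinaryQuadraticForm.classNumber (-43) ∧
        3 ∣ BinaryQuadraticForm.classNumber (-547)) := by
  refine ⟨⟨by decide, ?_, ?_⟩, ⟨by decide, ?_, ?_⟩, ⟨by decide, ?_, ?_⟩, ⟨by decide, ?_, ?_⟩,
    ⟨by decide, ?_, ?_⟩⟩ <;> decide +kernel

/-- The structured witnesses are primes `≡ 3 (mod 4)` (so `−p` is fundamental, one genus). -/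
theorem structuredWitnesses_prime :
    ∀ p ∈ ({7, 11, 23, 43, 67, 83, 131, 283, 367, 547} : Finset ℕ), p.Prime ∧ p % 4 = 3 := by
  decide +kernel

/-- **Not a function of the small quadratic characters either** ("Rédei data at 3" has nothing to
act on for prime discriminants; this checks the next-cheapest proposal, a formula in
`(p mod 8, (p/3), (p/5), (p/7), (p/11))`): `p = 139` and `q = 19` are primes `≡ 3 (mod 8)` with the
same quadratic character at `3, 5, 7, 11`, yet `h(−139) = 3`, `h(−19) = 1`. (With `13` added the
smallest such pair is `(83, 227)`.) Kernel-checked. -/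
theorem threeDvd_not_function_of_small_characters :
    Nat.Prime 139 ∧ Nat.Prime 19 ∧ 139 % 8 = 19 % 8 ∧
      (IsSquare (139 : ZMod 3) ↔ IsSquare (19 : ZMod 3)) ∧
      (IsSquare (139 : ZMod 5) ↔ IsSquare (19 : ZMod 5)) ∧
      (IsSquare (139 : ZMod 7) ↔ IsSquare (19 : ZMod 7)) ∧
      (IsSquare (139 : ZMod 11) ↔ IsSquare (19 : ZMod 11)) ∧
      BinaryQuadraticForm.classNumber (-139) = 3 ∧ BinaryQuadraticForm.classNumber (-19) = 1 := by
  refine ⟨by norm_num, by norm_num, by decide, by decide, by decide, by decide, by decide, ?_, ?_⟩ <;>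
    decide +kernel

/-! ## §3 Symmetry of the target class -/

/-- `co BPP = BPP`, membership form. -/
theorem compl_mem_BPP_iff (L : Language Bool) : Lᶜ ∈ BPP ↔ L ∈ BPP := by
  have h : co BPP = BPP := co_BPP_holds
  constructor
  · intro hc
    have : L ∈ co BPP := by
      change Lᶜ ∈ BPP
      exact hc
    rwa [h] at this
  · intro hL
    have : Lᶜ ∈ co BPP := by
      change Lᶜᶜ ∈ BPP
      rwa [compl_compl]
    rwa [h] at this

/-- The crux is equivalently the non-membership of the COMPLEMENT language (non-codewords ∪
non-fundamental ∪ `3 ∤ h`): the target class is YES/NO-symmetric, unlike the certificate structure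
(NP witnesses for `3 ∣ h` — cubic fields —, none known GRH-free for `3 ∤ h`). -/
theorem iqThreeNotBPP_iff_compl :
    IqThreeNotBPP ↔ (encodingNatBool.toLanguage iqThreeSet)ᶜ ∉ BPP := by
  rw [iqThreeNotBPP_iff, compl_mem_BPP_iff]

/-! ## §4 Load-bearing analysis of the conjuncts of `S` -/

/-- VARIANT `WithoutThree`: drop the class-number conjunct — "fundamentality is BPP-hard". Equivalent
(one-query Karp reductions both ways: `m ↦ 4m`/`m ↦ m·ℓ`) to SQUAREFREES ∉ BPP, the Adleman–McCurley
open problem; neither refutable nor provable here. NOT implied by and does NOT imply the crux by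
any argument in hand (a refutation of the crux yields it only through planting, §5). -/
def WithoutThree : Prop :=
  encodingNatBool.toLanguage {d : ℕ | IsNegFundamentalDiscr d} ∉ BPP

/-- VARIANT `WithoutFund`: drop fundamentality — `3 ∣ h(D)` over ALL negative discriminants (orders
of conductor `f` included, where `h(f²D₀) = h(D₀)·f·∏(1 − χ(p)/p)/[units]` multiplies by KNOWN
factors). Open; incomparable with the crux as far as proved implications go. -/
def WithoutFund : Prop :=
  encodingNatBool.toLanguage {d : ℕ | 3 ∣ BinaryQuadraticForm.classNumber (-(d : ℤ))} ∉ BPP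

/-- VARIANT `PrimesOnly` (the prime core, ideator-1 memo M6): `{p prime : p ≡ 3 (4), 3 ∣ h(−p)} ∉ BPP`.
A STRENGTHENING of the crux (`iqThreeNotBPP_of_primesOnly`), factoring-free by construction. -/
def PrimesOnly : Prop :=
  encodingNatBool.toLanguage (iqThreeSet ∩ {p : ℕ | p.Prime}) ∉ BPP

/-- On primes the fundamentality literal is just `p ≡ 3 (mod 4)`. -/
theorem isNegFundamentalDiscr_iff_of_prime {p : ℕ} (hp : p.Prime) :
    IsNegFundamentalDiscr p ↔ p % 4 = 3 := by
  have hsq : Squarefree (-(p : ℤ)) :=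
    (Int.prime_iff_natAbs_prime.2 (by simpa using hp)).squarefree
  have h2 := hp.two_le
  constructor
  · rintro (⟨h, -, -⟩ | ⟨h, -, -⟩)
    · omega
    · exfalso
      have h4 : (4 : ℤ) ∣ (p : ℤ) := (Int.dvd_neg).1 h
      have h4' : 4 ∣ p := by exact_mod_cast h4
      rcases (Nat.dvd_prime hp).1 h4' with h44 | h44
      · omega
      · rw [← h44] at hp
        exact absurd hp (by decide)
  · intro h
    exact Or.inl ⟨by omega, hsq, by omega⟩

/-- The prime core, unfolded: `S ∩ PRIMES = {p prime : p ≡ 3 (mod 4) ∧ 3 ∣ h(−p)}`. -/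
theorem iqThreeSet_inter_primes :
    iqThreeSet ∩ {p : ℕ | p.Prime} =
      {p : ℕ | p.Prime ∧ p % 4 = 3 ∧ 3 ∣ BinaryQuadraticForm.classNumber (-(p : ℤ))} := by
  ext p
  simp only [iqThreeSet, Set.mem_inter_iff, Set.mem_setOf_eq]
  constructor
  · rintro ⟨⟨hf, h3⟩, hp⟩
    exact ⟨hp, (isNegFundamentalDiscr_iff_of_prime hp).1 hf, h3⟩
  · rintro ⟨hp, h4, h3⟩
    exact ⟨⟨(isNegFundamentalDiscr_iff_of_prime hp).2 h4, h3⟩, hp⟩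

/-- **`BPP` is closed under intersection with a `P` language** (witness `L' ⊓ fst⁻¹ K`; on `x ∉ K`
every coin string is correct). Elementary; recorded here because the tree has `inter_mem_P` and
truth-table closure but not this one-liner by name. -/
theorem inter_mem_BPP_of_mem_P {L K : Language Bool} (hL : L ∈ BPP) (hK : K ∈ Classes.P) :
    L ⊓ K ∈ BPP := by
  obtain ⟨L', hL', p, hp⟩ := hL
  refine ⟨L' ⊓ (fstF ⁻¹' K), inter_mem_P hL' (preimage_mem_P hK fstF_mem_FP), p, fun x => ?_⟩
  have hmem : ∀ z : List Bool, z ∈ L' ⊓ (fstF ⁻¹' K) ↔ z ∈ L' ∧ fstF z ∈ K := fun z => Iff.rfl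
  have hmem' : ∀ z : List Bool, z ∈ L ⊓ K ↔ z ∈ L ∧ z ∈ K := fun z => Iff.rfl
  by_cases hx : x ∈ K
  · have hset : {y : List Bool | boolPair x y ∈ L' ⊓ (fstF ⁻¹' K) ↔ x ∈ L ⊓ K} =
        {y : List Bool | boolPair x y ∈ L' ↔ x ∈ L} := by
      ext y
      simp only [Set.mem_setOf_eq, hmem, hmem', fstF_boolPair, hx, and_true]
    rw [hset]
    exact hp x
  · have hset : {y : List Bool | boolPair x y ∈ L' ⊓ (fstF ⁻¹' K) ↔ x ∈ L ⊓ K} = Set.univ := by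
      ext y
      simp only [Set.mem_setOf_eq, hmem, hmem', fstF_boolPair, hx, and_false, Set.mem_univ]
    rw [hset, uniformProb_univ]
    norm_num

/-- Encoded languages commute with intersection (injectivity of the encoding). -/
theorem toLanguage_inter (A B : Set ℕ) :
    encodingNatBool.toLanguage (A ∩ B) = encodingNatBool.toLanguage A ⊓ encodingNatBool.toLanguage B :=
  Set.image_inter encodingNatBool.encode_injective

/-- **The prime core suffices**: `PrimesOnly → IqThreeNotBPP` (if `IQ3 ∈ BPP` then
`IQ3 ∩ PRIMES ∈ BPP`, `PRIMES ∈ P` by AKS, tree theorem `PRIMES_mem_P'`). Contrapositive reading for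
refuters: a refutation of the crux must in particular decide `3 ∣ h(−p)` on PRIMES `p ≡ 3 (4)` in
BPP — no squarefreeness anywhere, one genus, no Rédei data: the class-number conjunct ALONE is
load-bearing. -/
theorem iqThreeNotBPP_of_primesOnly (h : PrimesOnly) : IqThreeNotBPP := by
  rw [iqThreeNotBPP_iff]
  intro hIQ
  apply h
  rw [toLanguage_inter]
  exact inter_mem_BPP_of_mem_P hIQ PRIMES_mem_P'

/-! ## §5 Line `Sketch`: joint sufficiency, and a Hasse-free planting lemma (near-miss) -/

/-- **Nagell planting, kernel-checked INSTANCES.** `d = u(4c³ − u)`, `gcd(c, u) = 1`, `2 ≤ c`: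
`(c,u) = (2,1) ↦ 31`, `(2,3) ↦ 87`, `(3,1) ↦ 107`, `(2,11) ↦ 231`, `(2,13) ↦ 247`, `(2,15) = (4,1) ↦ 255`,
`(5,1) ↦ 499`; all have `3 ∣ h(−d)` (`h = 3, 6, 3, 12, 6, 12, 3`). (Python check this session:
all 60 squarefree instances with `d ≤ 3000`, `c ≤ 8`, AND all non-squarefree ones, `0` failures.) -/
theorem nagell_instances :
    BinaryQuadraticForm.classNumber (-31) = 3 ∧ BinaryQuadraticForm.classNumber (-87) = 6 ∧
    BinaryQuadraticForm.classNumber (-107) = 3 ∧ BinaryQuadraticForm.classNumber (-231) = 12 ∧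
    BinaryQuadraticForm.classNumber (-247) = 6 ∧ BinaryQuadraticForm.classNumber (-255) = 12 ∧
    BinaryQuadraticForm.classNumber (-499) = 3 := by
  refine ⟨?_, ?_, ?_, ?_, ?_, ?_, ?_⟩ <;> decide +kernel

/-- **NEAR-MISS (not closed this cycle): Nagell's lemma — Hasse-FREE planting of `3 ∣ h`.**
For `2 ≤ c`, `1 ≤ u < 4c³`, `gcd(c, u) = 1`, put `a = c²`, `b = 2c³ − u`, `d = u(4c³ − u)`, so
`b² + d = 4a³`. CLAIM: `3 ∣ h(−d)` (for every such `d`; the reduction needs it only for `−d`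
fundamental, which is the case typed below via the bridge `h(−d) = #Cl(𝓞_K)`).
ELEMENTARY IDEAL-THEORETIC PROOF (no class field theory, no Dirichlet composition), in the
vocabulary of the tree's `FormIdeals.lean` / `FormIdealsStructure.lean` (quadratic ring `R = 𝓞 K`,
`ℤ`-basis `(1, ω)`, `ω² = m + tω`, `d_K = t² + 4m = −d`): `b ≡ t (mod 2)` (as `b² ≡ d_K (mod 4)`),
`k := (b + t)/2`, `η := ω − k`, `N(η) = k² − tk − m = (b² − d_K)/4 = a³`, `η + η̄ = −b`.
Let `𝔞 = (a, η)` (the lattice `ℤa ⊕ ℤη`, `mem_span_pair_iff_of_basis` with `A = a`, `C = a²`).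
With `ua + vb = 1` (from `gcd(c, u) = 1 ⇒ gcd(a, b) = 1`):
  (i)  `η² = −bη − a³`, hence `𝔞² = (a², aη, η²) = (a², aη, bη) = (a², η)` (`η = u·aη + v·bη`);
  (ii) `𝔞³ = (a², η)(a, η) = (a³, aη, η²) = (a³, η) = (η)` (`a³ = ηη̄ ∈ (η)`): PRINCIPAL;
  (iii) `𝔞𝔞̄ = (a², aη, aη̄, a³) = a·(a, η, η̄) = (a)` (`η + η̄ = −b`, `gcd(a,b) = 1 ⇒ 1 ∈ (a, η, η̄)`);
  (iv) `𝔞` is NOT principal: `𝔞 = (α)` gives `(a) = 𝔞𝔞̄ = (αᾱ) = (N α)`, so `N α = a = c²`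
       (positive-definite norm form); writing `α = p + qω`, `4Nα = (2p + tq)² + d q²`, so `q ≠ 0`
       forces `4c² ≥ d`, false (`d ≥ 4c³ − 1 > 4c²`), and `q = 0` gives `𝔞 = (c)`, `c ∣ η = ω − k`,
       contradicting the `ω`-coordinate `1` (`intCast_add_intCast_mul_inj`) as `c ≥ 2`.
  (v)  so `ClassGroup.mk0 𝔞` has order `3`, `3 ∣ #Cl(𝓞_K) = h(d_K) = classNumber (−d)`
       (`orderOf_dvd_card`; bridge `card_reducedForms_eq_classNumber` +
       `exists_numberField_discr_eq`, both used in `IqThreeNotPPoly/Negative/GenusTwoParity.lean`).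
Tree pieces at hand: `HeegnerCondition` (`exists_basis_zero_eq_one`, `basis_one_mul_self_eq`,
`discr_eq_sq_add_four_mul`), `FormIdeals` (`mem_span_pair_iff_of_basis`, `intCast_mem_span_pair_iff`,
`sub_mul_sub_eq`), `FormIdealsStructure.span_pair_mul_span_pair_of_isCoprime` (pattern for (i)–(ii)),
`IntegralBasisConjugation` (for (iii)), `IdealClassInverse.mk0_formIdeal_neg_eq_inv`. Size: M
(≈ 500 lines). Kernel-checked INSTANCES: `nagell_instances` above; Python: all `(c,u)` with
`d ≤ 3000`, `c ≤ 8`: 0 failures (squarefree or not).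
USE (line `Sketch` / sibling 2422): replaces the socket `stub_hasseDictionary` by a theorem, with
the sampler `d = N·t·(4c³ − N·t)`, `t = 1 + 2Nk`, `c = 2^e` minimal with `2c³ ≥ N·t_max` (`N, t`
odd ⇒ `gcd(c, Nt) = 1`, `d ≡ 7 (mod 8)`, `d ≥ 2c³`; even `N = 2N'` first mapped to `N'`, `4 ∣ N`
rejected outright): NO side exact for the same reason as the landed `stub_oneSidedAP` (`p² ∣ N ⇒
p² ∣ d`, `p` odd), YES density by the same two-linear-factor squarefree sieve as
`stub_fundDensityAP` (`t` and `4c³ − N − 2N²k`). Then the refutation floor is UNCONDITIONAL: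
`¬IqThreeNotBPP → SQUAREFREES ∈ BPP`, and the sibling's `¬IqThreeNotPPoly → SQUAREFREES ∈ P/poly`
likewise loses Hasse. -/
theorem nagell_three_dvd_classNumber (c u : ℕ) (hc : 2 ≤ c) (hu : 1 ≤ u) (hlt : u < 4 * c ^ 3)
    (hcu : Nat.Coprime c u) (hfund : IsNegFundamentalDiscr (u * (4 * c ^ 3 - u))) :
    3 ∣ BinaryQuadraticForm.classNumber (-((u * (4 * c ^ 3 - u) : ℕ) : ℤ)) := by
  sorry

end Summit.QuantumAdvantage.QuantumAdvantage.Cruxes.IqThreeNotBPP.Disproof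

end
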